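/-
Copyright (c) 2026 the pub-hodgecm-mathlib formalisation cell (harness21).  Prover seat hodgecm-mathlib-LH4-p01 (g10): road M6 → F3 «TOT-Λ BY OVER-ORDERS» (LEAD F0P3a-plan
T14-66 ∕ T15-32 «GO-LOW»), brick F5-(0) «FRAME DISCHARGE AT THE INERT PLACE» for the F3-5 ∕ F5 pen LH7-p04 (g12); 2026-09-03.
-/
import Literature.NumberTheory.Automorphic.SelfDualStableLatticeCountEisensteinData   -- ★ F3-5b-III-γ p853258 (LH7-p04 (g12)): `ncard_isSelfDualLattice_stable_eq_phiTHn_of_eisensteinData ∕ _phiTHprimen_of_eisensteinData`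
import Literature.NumberTheory.Rogawski1990.InertPlaceIntegralEisensteinFrame      -- ★ (c5-ii) FILE A p853133 (this seat): `exists_integralEisensteinFrame_inertPlace` (the 29-letter integral frame at the place)
import Literature.NumberTheory.Rogawski1990.EndoscopicBlockFrameBridge              -- ★ (c5-ii) FILE B p853134 (this seat): `finrank_eq_two_of_root`
import Literature.NumberTheory.Automorphic.QuadraticFixedNormSupply                 -- ★ (S2) p853117: `exists_mul_map_eq_of_valuation_eq` (the field-level norm supply `hnormK`)
import HarnessLib

/-!
# The self-dual lattices stable under a type-(2) pair, counted from its Eisenstein data — AT AN INERT CM PLACE (★ γ's heads with the frame letters discharged)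

Topic `NumberTheory/Rogawski1990`; namespace `Literature.NumberTheory.Rogawski1990`.  THEOREMS ONLY (no definition, no instance, no notation, no named fact, no `sorry`).
Cell `pub/hodgecm-mathlib` (D-0151), crux H413 = `stmt-HodgeConjecture-24833`; road M6 → F3 «TOT-Λ by over-orders», brick **F5-(0)**: the two heads of ★ F3-5b-III-γ
(`Literature.NumberTheory.Automorphic.ncard_isSelfDualLattice_stable_eq_phiTHn_of_eisensteinData` ∕ `…_phiTHprimen_of_eisensteinData`) SPECIALISED to the inert CM place:
`E := E_w = w.1.adicCompletion E` (`w ∣ v` a place of the CM quadratic extension `E ∕ F` fixed by `c`, `v` unramified), `F := F_v`, `K := M_{w₁}` (`w₁ ∣ w` a place of the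
eigen-field `M ∕ E`, the `E_w`-algebra structure being the tree's instance, `algebraMap = toPlace w.1 w₁` definitionally), `σ := σ_w = galAdicCompletionMap c`, `σ_K := s̃`,
`ϖ := ι_w k₀`.  Of ★ γ's binders, the WHOLE abstract integral ∕ valued frame is DISCHARGED here: the 29 integral letters (★ (c5-ii) FILE A `exists_integralEisensteinFrame_inertPlace`),
`[K : E] = 2` (★ FILE B `finrank_eq_two_of_root`), the isometries `|σ x| = |x|` (★ `valued_galAdicCompletionMap`), `|ι₁ y| = |y|²` (★ `valued_toPlace`, the ramification index `2`
being READ OFF the Eisenstein equation `θ² = ι₁ι(a_F)θ + ι₁ι(k₀)`, `|θ| = |k₀| = q⁻¹`, `|a_F| < 1`), `|ϖ| = q⁻¹` (★ `valued_toPlace_of_isUnramifiedIn`), and the field-level norm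
supply `hnormK` (★ (S2) `exists_mul_map_eq_of_valuation_eq` on FILE A's `hnorm₁`).  What REMAINS a binder is row-∕pair-∕form-level and is held verbatim by F5: the field-level
θ-package of the row (`haF hk₀ hθ hθv hcoord hint hs̃ι hs̃θ hs̃s̃ hs̃O hs̃v hnorm1` — ★ FILE C `exists_thetaPackage_uniformiserRow` ∕ ★ FILE C-W `exists_thetaPackage_wildUnitRow`
deliver them in one `obtain`), the form (`J hJ hJh hL₀ htrans`), the block ∕ endoscopic frame (`cfr φb hφb`; `φ hφ hstar hφx hK hall hcoordlam` = ★ FILE B's conclusions at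
the unitary pair, valid at every shift), the pair's Eisenstein data in ★ (W1)'s `Valued` letters (`χ_g` rootless and `g₁₀ ≠ 0` being DERIVED, ★ (c5-i) `charpoly_ne_zero_of_eisensteinData`), the ⋆-polynomial
(★ D′β), the `Valued`∕Krylov gate `hgateV` (★ C8-odd ∕ C8-unit) and the class token.  PROOF = one `obtain` (FILE A) + the five valuation bridges + `exact` ★ γ.
HONEST LABEL: HC_CM is proved only modulo the 2 remaining named inputs (hLiu418 24832, h413 24833) until rung 0 closes; assembly of ★ bricks, asserts nothing printed;
count-neutral (pays no organ; zero label movement until F5 ★ and a desk-priced rider).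

* **`ncard_isSelfDualLattice_stable_eq_phiTHn_inertPlace`** (class I), **`ncard_isSelfDualLattice_stable_eq_phiTHprimen_inertPlace`** (class II).

## References
* [Rogawski1990] J. D. Rogawski, *Automorphic Representations of Unitary Groups in Three Variables*, Ann. of Math. Stud. 123 (1990): §4.9 Lemma 4.9.3 p. 56, Prop. 4.9.1 (b) p. 55.
* [Kottwitz1986BaseChangeUnits] R. E. Kottwitz, *Base change for unit elements of Hecke algebras*, Compositio Math. 60 (1986): §1 pp. 240–241, §3.
* [Flicker1998UnitaryFL] Y. Z. Flicker, *Elementary proof of the fundamental lemma for a unitary group*, Canad. J. Math. 50 (1998): Props. 7, 11, 16–17, Theorem 18 p. 97.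
* [SerreLocalFields1979] J.-P. Serre, *Local Fields*, GTM 67 (1979): Ch. I §6 Prop. 17–18 (Eisenstein equations, `e = 2`), Ch. V §2 Prop. 3 (norms of units).
-/

set_option autoImplicit false

noncomputable section

open Matrix Polynomial ValuativeRel NumberField IsDedekindDomain
open scoped MatrixGroups ValuativeRel Pointwise WithZero
open Literature.NumberTheory.Automorphic Literature.NumberTheory.Automorphic.UnitaryGroup Literature.NumberTheory.NumberFields
  Literature.NumberTheory.Rogawski1990.Flicker1998 Literature.NumberTheory.Automorphic.UnitaryLatticeTree Literature.NumberTheory.Automorphic.HermitianLattice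

namespace Literature.NumberTheory.Rogawski1990

variable {F E : Type} [Field F] [NumberField F] [Field E] [NumberField E] [Algebra F E] [Algebra.IsQuadraticExtension F E]
  (c : E ≃ₐ[F] E) (v : HeightOneSpectrum (𝓞 F)) (hc : c ≠ 1) (hunr : Algebra.IsUnramifiedIn (𝓞 E) v.asIdeal)
  (w : PlacesOver E v) (hw : c • w.1 = w.1)
  {M : Type} [Field M] [NumberField M] [Algebra E M] (w₁ : PlacesOver M w.1)
  -- the field-level θ-package of the row (★ FILE C `exists_thetaPackage_uniformiserRow` ∕ ★ FILE C-W `exists_thetaPackage_wildUnitRow`)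
  {aF k₀ : v.adicCompletion F} (haF : Valued.v aF < 1) (hk₀ : Valued.v k₀ = WithZero.exp (-1 : ℤ))
  {θ : w₁.1.adicCompletion M} (s' : w₁.1.adicCompletion M →+* w₁.1.adicCompletion M)
  (hθ : θ ^ 2 = toPlace w.1 w₁ (toPlace v w aF) * θ + toPlace w.1 w₁ (toPlace v w k₀)) (hθv : Valued.v θ = WithZero.exp (-1 : ℤ))
  (hcoord : ∀ z : w₁.1.adicCompletion M, ∃! pq : w.1.adicCompletion E × w.1.adicCompletion E, z = toPlace w.1 w₁ pq.1 + toPlace w.1 w₁ pq.2 * θ)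
  (hint : ∀ p q : w.1.adicCompletion E, toPlace w.1 w₁ p + toPlace w.1 w₁ q * θ ∈ 𝒪[w₁.1.adicCompletion M] ↔ p ∈ 𝒪[w.1.adicCompletion E] ∧ q ∈ 𝒪[w.1.adicCompletion E])
  (hs'ι : ∀ x, s' (toPlace w.1 w₁ x) = toPlace w.1 w₁ (galAdicCompletionMap (L := E) c hw x)) (hs'θ : s' θ = θ) (hs's' : ∀ z, s' (s' z) = z)
  (hs'O : ∀ z : 𝒪[w₁.1.adicCompletion M], s' z ∈ 𝒪[w₁.1.adicCompletion M]) (hs'v : ∀ z, Valued.v (s' z) = Valued.v z)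
  (hnorm1 : ∀ c₁ : w₁.1.adicCompletion M, c₁ ≠ 0 → s' c₁ = c₁ → Even (WithZero.log (Valued.v c₁)) → ∃ a : w₁.1.adicCompletion M, a * s' a * c₁ = 1)
  -- the form (F5's choice) and its two facts
  (J : GL (Fin 3) (w.1.adicCompletion E)) (hJ : J ∈ glInt 3 (w.1.adicCompletion E))
  (hJh : ((J : Matrix (Fin 3) (Fin 3) (w.1.adicCompletion E)).map (galAdicCompletionMap (L := E) c hw))ᵀ = J)
  (hL₀ : IsSelfDualLattice (galAdicCompletionMap (L := E) c hw) (toPlace v w k₀) (J : Matrix (Fin 3) (Fin 3) (w.1.adicCompletion E)) (stdLattice (w.1.adicCompletion E) 3))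
  (htrans : ∀ Λ : Submodule (Valued.integer (w.1.adicCompletion E)) (Fin 3 → w.1.adicCompletion E),
    IsSelfDualLattice (galAdicCompletionMap (L := E) c hw) (toPlace v w k₀) (J : Matrix (Fin 3) (Fin 3) (w.1.adicCompletion E)) Λ →
    ∃ g₁ : ↥(unitaryGroupOfForm (galAdicCompletionMap (L := E) c hw) (J : Matrix (Fin 3) (Fin 3) (w.1.adicCompletion E))),
      Λ = mapGL ((g₁ : ↥(unitaryGroupOfForm (galAdicCompletionMap (L := E) c hw) (J : Matrix (Fin 3) (Fin 3) (w.1.adicCompletion E)))) :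
        GL (Fin 3) (w.1.adicCompletion E)) (stdLattice (w.1.adicCompletion E) 3))
  -- the block frame and its endoscopic presentation at the pair (★ FILE B's conclusions at the unitary pair, reused at its shifts)
  (cfr : GL (Fin 3) (w.1.adicCompletion E))
  (φb : (Matrix (Fin 2) (Fin 2) (w.1.adicCompletion E) × w.1.adicCompletion E) →ₐ[w.1.adicCompletion E] Matrix (Fin 3) (Fin 3) (w.1.adicCompletion E))
  (hφb : ∀ (g : Matrix (Fin 2) (Fin 2) (w.1.adicCompletion E)) (u : w.1.adicCompletion E),
    φb (g, u) = (cfr : Matrix (Fin 3) (Fin 3) (w.1.adicCompletion E)) *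
      Matrix.reindex endoPerm endoPerm (Matrix.fromBlocks g 0 0 (u • (1 : Matrix (Fin 1) (Fin 1) (w.1.adicCompletion E)))) *
      ((cfr⁻¹ : GL (Fin 3) (w.1.adicCompletion E)) : Matrix (Fin 3) (Fin 3) (w.1.adicCompletion E)))
  (φ : (w.1.adicCompletion E × w₁.1.adicCompletion M) →ₐ[w.1.adicCompletion E] Matrix (Fin 3) (Fin 3) (w.1.adicCompletion E)) (hφ : Function.Injective φ)
  (hstar : ∀ b : w.1.adicCompletion E × w₁.1.adicCompletion M, (J : Matrix (Fin 3) (Fin 3) (w.1.adicCompletion E)) *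
    φ (RingHom.prodMap (galAdicCompletionMap (L := E) c hw) s' b) = ((φ b).map (galAdicCompletionMap (L := E) c hw))ᵀ * J)
  -- the pair's Eisenstein data in ★ (W1)'s `Valued` letters, a root `λ ∈ M_{w₁}` of `χ_g`, the Krylov unit, the ⋆-polynomial
  {g Θ : Matrix (Fin 2) (Fin 2) (w.1.adicCompletion E)} {u α β a b : w.1.adicCompletion E} {n N : ℕ}
  (hg : ∀ i j, g i j ∈ 𝒪[w.1.adicCompletion E]) (hu : u ∈ 𝒪[w.1.adicCompletion E])
  (hΘ : Θ = α • 1 + β • g) (hΘd : Valued.v Θ.det = Valued.v (toPlace v w k₀)) (hΘt : Valued.v Θ.trace < 1)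
  (hrel : u • (1 : Matrix (Fin 2) (Fin 2) (w.1.adicCompletion E)) - g = a • 1 + b • Θ)
  (hn : Valued.v (u • (1 : Matrix (Fin 2) (Fin 2) (w.1.adicCompletion E)) - g).det = Valued.v (toPlace v w k₀) ^ n)
  (hb : Valued.v b = Valued.v (toPlace v w k₀) ^ N)
  {lam : w₁.1.adicCompletion M} (hlam : lam ^ 2 - toPlace w.1 w₁ g.trace * lam + toPlace w.1 w₁ g.det = 0)
  (hφx : φ ((u, lam) : w.1.adicCompletion E × w₁.1.adicCompletion M) = φb (g, u))
  (hK : IsUnit (Matrix.of fun i j : Fin 3 => (((φb (g, u)) ^ (j : ℕ)) *ᵥ ((cfr : Matrix (Fin 3) (Fin 3) (w.1.adicCompletion E)) *ᵥ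
    (Pi.single (endoPerm (Sum.inl 0)) (1 : w.1.adicCompletion E) + Pi.single (endoPerm (Sum.inr 0)) (1 : w.1.adicCompletion E)))) i).det)
  (hall : ∀ x : w.1.adicCompletion E × w₁.1.adicCompletion M, ∃ Q : (w.1.adicCompletion E)[X], aeval ((u, lam) : w.1.adicCompletion E × w₁.1.adicCompletion M) Q = x)
  (hcoordlam : ∀ z : w₁.1.adicCompletion M, ∃ p q : w.1.adicCompletion E, z = toPlace w.1 w₁ p + toPlace w.1 w₁ q * lam)
  (P : (w.1.adicCompletion E)[X]) (hP : ∀ i, P.coeff i ∈ 𝒪[w.1.adicCompletion E])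
  (hPx : aeval ((u, lam) : w.1.adicCompletion E × w₁.1.adicCompletion M) P = (galAdicCompletionMap (L := E) c hw u, s' lam))
  -- THE GATE in `Valued`∕Krylov currency (★ C8-odd ∕ ★ C8-unit), at the place
  (hgateV : ∀ (u' p' q' t' D' : w.1.adicCompletion E) (N'' b' : ℕ),
    ((u', toPlace w.1 w₁ p' + toPlace w.1 w₁ q' * θ) : w.1.adicCompletion E × w₁.1.adicCompletion M) *
      RingHom.prodMap (galAdicCompletionMap (L := E) c hw) s' ((u', toPlace w.1 w₁ p' + toPlace w.1 w₁ q' * θ) : w.1.adicCompletion E × w₁.1.adicCompletion M) = 1 →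
    Valued.v (u' - 1) < 1 → Valued.v (p' - 1) < 1 → Valued.v q' = WithZero.exp (-(N'' : ℤ)) →
    (toPlace w.1 w₁ p' + toPlace w.1 w₁ q' * θ) ^ 2 - toPlace w.1 w₁ t' * (toPlace w.1 w₁ p' + toPlace w.1 w₁ q' * θ) + toPlace w.1 w₁ D' = 0 →
    Valued.v (u' * u' - t' * u' + D') = WithZero.exp (-(b' : ℤ)) →
    ((∃ x : Fin 3 → w.1.adicCompletion E, ∃ g₁ ∈ unitaryGroupOfForm (galAdicCompletionMap (L := E) c hw) (J : Matrix (Fin 3) (Fin 3) (w.1.adicCompletion E)),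
      Submodule.span 𝒪[w.1.adicCompletion E] (Set.range fun k : Fin 3 =>
        ((φ ((u', toPlace w.1 w₁ p' + toPlace w.1 w₁ q' * θ) : w.1.adicCompletion E × w₁.1.adicCompletion M)) ^ (k : ℕ)) *ᵥ x) =
        Submodule.span 𝒪[w.1.adicCompletion E] (Set.range ((g₁ : Matrix (Fin 3) (Fin 3) (w.1.adicCompletion E)))ᵀ)) ↔
    Even (WithZero.log (Valued.v (∑ k, ∑ i,
      galAdicCompletionMap (L := E) c hw (((cfr : Matrix (Fin 3) (Fin 3) (w.1.adicCompletion E)) *ᵥ Pi.single (endoPerm (Sum.inr 0)) (1 : w.1.adicCompletion E)) i) *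
      (J : Matrix (Fin 3) (Fin 3) (w.1.adicCompletion E)) i k *
      ((cfr : Matrix (Fin 3) (Fin 3) (w.1.adicCompletion E)) *ᵥ Pi.single (endoPerm (Sum.inr 0)) (1 : w.1.adicCompletion E)) k)) + b')))

/-! ## §1 The valuation bridges at the place: `e(w₁ ∣ w) = 2` read off the Eisenstein equation, and the field-level norm supply -/

omit [Algebra.IsQuadraticExtension F E] in
include hunr hk₀ hθ hθv haF in
/-- **`e(w₁ ∣ w) = 2` FROM THE EISENSTEIN EQUATION**: if `θ² = ι₁ι(a_F)·θ + ι₁ι(k₀)` with `|θ|_{w₁} = q⁻¹`, `|k₀|_v = q⁻¹`, `|a_F|_v < 1` and `v` unramified in `E`, then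
`|ι₁ y|_{w₁} = |y|_w ²` — the ramification index `e` of ★ `valued_toPlace` is `2`: `e = 0` contradicts `ι₁ 0 = 0`; `e = 1` gives `|θ²| = |ι₁ι k₀| = q⁻¹ ≠ q⁻²`; `e ≥ 3` gives
`|θ²| ≤ q⁻³`. [cite: SerreLocalFields1979, Ch. I §6 Prop. 17–18] -/
theorem valued_toPlace_eq_sq_of_eisenstein (y : w.1.adicCompletion E) : Valued.v (toPlace w.1 w₁ y) = Valued.v y ^ 2 := by
  have hιv : ∀ y : v.adicCompletion F, Valued.v (toPlace v w y) = Valued.v y :=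
    fun y => Literature.NumberTheory.Automorphic.Liu2021.LemD1IndexedNonVacuityInertCofinite.valued_toPlace_of_isUnramifiedIn E v hunr w y
  have hle : ∀ x : ℤᵐ⁰, x < 1 → x ≤ WithZero.exp (-1 : ℤ) := fun x hx => by
    rcases eq_or_ne x 0 with h0 | h0
    · rw [h0]; exact zero_le
    · rw [← WithZero.exp_log h0] at hx ⊢
      rw [← WithZero.exp_zero, WithZero.exp_lt_exp] at hx
      exact WithZero.exp_le_exp.2 (by omega)
  suffices he : w.1.asIdeal.ramificationIdx' w₁.1.asIdeal = 2 by rw [valued_toPlace, he]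
  have hι₁ : ∀ y : w.1.adicCompletion E, Valued.v (toPlace w.1 w₁ y) = Valued.v y ^ w.1.asIdeal.ramificationIdx' w₁.1.asIdeal :=
    fun y => valued_toPlace w.1 w₁ y
  have h2 : Valued.v (toPlace w.1 w₁ (toPlace v w aF) * θ + toPlace w.1 w₁ (toPlace v w k₀)) = WithZero.exp (-2 : ℤ) := by
    rw [← hθ, map_pow, hθv, ← WithZero.exp_nsmul]; rfl
  have hB : Valued.v (toPlace w.1 w₁ (toPlace v w k₀)) = WithZero.exp (-1 : ℤ) ^ w.1.asIdeal.ramificationIdx' w₁.1.asIdeal := by rw [hι₁, hιv, hk₀]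
  have hA : Valued.v (toPlace w.1 w₁ (toPlace v w aF) * θ) ≤ WithZero.exp (-1 : ℤ) ^ w.1.asIdeal.ramificationIdx' w₁.1.asIdeal * WithZero.exp (-1 : ℤ) := by
    rw [map_mul, hι₁, hιv, hθv]; exact mul_le_mul_left (pow_le_pow_left' (hle _ haF) _) _
  by_contra hne
  rcases (by omega : w.1.asIdeal.ramificationIdx' w₁.1.asIdeal = 0 ∨ w.1.asIdeal.ramificationIdx' w₁.1.asIdeal = 1 ∨
      3 ≤ w.1.asIdeal.ramificationIdx' w₁.1.asIdeal) with h0 | h1 | h3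
  · have h := hι₁ 0
    rw [map_zero, map_zero, h0, pow_zero] at h
    exact zero_ne_one h
  · rw [h1, pow_one] at hA hB
    have hlt : Valued.v (toPlace w.1 w₁ (toPlace v w aF) * θ) < Valued.v (toPlace w.1 w₁ (toPlace v w k₀)) := by
      rw [hB]; refine lt_of_le_of_lt hA ?_
      rw [← WithZero.exp_add, WithZero.exp_lt_exp]; norm_num
    rw [Valuation.map_add_eq_of_lt_right _ hlt, hB, WithZero.exp_inj] at h2
    norm_num at h2
  · have h3' : Valued.v (toPlace w.1 w₁ (toPlace v w aF) * θ + toPlace w.1 w₁ (toPlace v w k₀)) ≤ WithZero.exp (-3 : ℤ) := by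
      refine Valuation.map_add_le _ (hA.trans ?_) (hB.trans_le ?_)
      · rw [← WithZero.exp_nsmul, ← WithZero.exp_add, WithZero.exp_le_exp, nsmul_eq_mul]; omega
      · rw [← WithZero.exp_nsmul, WithZero.exp_le_exp, nsmul_eq_mul]; omega
    rw [h2, WithZero.exp_le_exp] at h3'
    norm_num at h3'

omit [NumberField F] [NumberField E] [Algebra.IsQuadraticExtension F E] in
include hs's' hnorm1 in
/-- **THE FIELD-LEVEL NORM SUPPLY `hnormK` AT THE PLACE**: for `c ≠ 0` fixed by `s̃` and `x` with `|x·s̃x| = |c|`, `c = t·s̃t` — ★ (S2) `exists_mul_map_eq_of_valuation_eq` on the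
unit-norm clause, itself the `k = 0` row of the package's (nK) clause `hnorm1`. [cite: SerreLocalFields1979, Ch. V §2 Prop. 3] -/
theorem exists_mul_map_eq_of_valuation_eq_inertPlace (x c₁ : w₁.1.adicCompletion M) (hc0 : c₁ ≠ 0) (hσc : s' c₁ = c₁)
    (hx : Valued.v (x * s' x) = Valued.v c₁) : ∃ t : w₁.1.adicCompletion M, t * s' t = c₁ := by
  have hnormU : ∀ u₁ : w₁.1.adicCompletion M, Valued.v u₁ = 1 → s' u₁ = u₁ → ∃ t : w₁.1.adicCompletion M, t * s' t = u₁ := by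
    intro u₁ hu₁ hsu₁
    have hu0 : u₁ ≠ 0 := fun h0 => by rw [h0, map_zero] at hu₁; exact zero_ne_one hu₁
    obtain ⟨a, ha⟩ := hnorm1 u₁ hu0 hsu₁ (by rw [hu₁, ← WithZero.exp_zero, WithZero.log_exp]; exact Even.zero)
    exact (Literature.NumberTheory.Automorphic.exists_mul_map_mul_eq_one_iff s' u₁ hu0).2 ⟨a, ha⟩
  exact Literature.NumberTheory.Automorphic.exists_mul_map_eq_of_valuation_eq Valued.v s' hs's' hnormU x c₁ hc0 hσc hx

/-! ## §2 ★ γ's two heads at the inert place -/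

include hc hunr haF hk₀ hθ hθv hcoord hint hs'ι hs'θ hs's' hs'O hs'v hnorm1 hJ hJh hL₀ htrans hφb hφ hstar hg hu hΘ hΘd hΘt hrel hn hb hlam hφx hK hall hcoordlam hP hPx hgateV in
/-- **F5-(0), CLASS I: `#{Λ | IsSelfDualLattice σ_w (ι k₀) J Λ ∧ φ_b(g,u)·Λ ⊆ Λ} = Φ(t) = phiTHn q n N` AT THE INERT PLACE** — ★ γ
`ncard_isSelfDualLattice_stable_eq_phiTHn_of_eisensteinData` at `E := E_w`, `K := M_{w₁}`, `σ := σ_w`, `σ_K := s̃`, `ϖ := ι k₀`, every abstract frame letter discharged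
(★ FILE A's 29 integral letters, `[K : E] = 2`, the valuation bridges of §1, ★ (S2)'s `hnormK`); binders = the row's field-level θ-package, the form, the block ∕ endoscopic frame,
the pair's Eisenstein data, the ⋆-polynomial, the gate and the class-I token at the frame vector `x₀ = c·e₂`.
[cite: Rogawski1990, §4.9 Lemma 4.9.3 p. 56, Prop. 4.9.1 (b) p. 55] [cite: Kottwitz1986BaseChangeUnits, §1 pp. 240–241; §3] [cite: Flicker1998UnitaryFL, Prop. 11 p. 87; Theorem 18 p. 97] -/
theorem ncard_isSelfDualLattice_stable_eq_phiTHn_inertPlace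
    (hI : ∃ z : w.1.adicCompletion E, z ≠ 0 ∧ valuation (w.1.adicCompletion E) (galAdicCompletionMap (L := E) c hw z * z *
      dotProduct (fun i => galAdicCompletionMap (L := E) c hw (((cfr : Matrix (Fin 3) (Fin 3) (w.1.adicCompletion E)) *ᵥ
        Pi.single (endoPerm (Sum.inr 0)) (1 : w.1.adicCompletion E)) i))
        ((J : Matrix (Fin 3) (Fin 3) (w.1.adicCompletion E)) *ᵥ ((cfr : Matrix (Fin 3) (Fin 3) (w.1.adicCompletion E)) *ᵥ
          Pi.single (endoPerm (Sum.inr 0)) (1 : w.1.adicCompletion E)))) = 1) :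
    (({Λ : Submodule (Valued.integer (w.1.adicCompletion E)) (Fin 3 → w.1.adicCompletion E) |
        IsSelfDualLattice (galAdicCompletionMap (L := E) c hw) (toPlace v w k₀) (J : Matrix (Fin 3) (Fin 3) (w.1.adicCompletion E)) Λ ∧
        Λ.map ((Matrix.toLin' (φb (g, u))).restrictScalars (Valued.integer (w.1.adicCompletion E))) ≤ Λ}.ncard : ℕ) : ℚ) =
      phiTHn (Nat.card 𝓀[v.adicCompletion F]) n N := by
  -- ### the valuation bridges at the place (§1, ★ `valued_galAdicCompletionMap`, ★ `valued_toPlace_of_isUnramifiedIn`)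
  have hσσ : ∀ x, galAdicCompletionMap (L := E) c hw (galAdicCompletionMap (L := E) c hw x) = x :=
    galAdicCompletionMap_galAdicCompletionMap_of_smul_eq c w hc hw
  have hσO : ∀ x : 𝒪[w.1.adicCompletion E], galAdicCompletionMap (L := E) c hw x ∈ 𝒪[w.1.adicCompletion E] :=
    fun x => mem_integer_galAdicCompletionMap c v w hw x
  have hσvV : ∀ x : w.1.adicCompletion E, Valued.v (galAdicCompletionMap (L := E) c hw x) = Valued.v x :=
    fun x => valued_galAdicCompletionMap (L := E) c hw x
  have hιv : ∀ y : v.adicCompletion F, Valued.v (toPlace v w y) = Valued.v y :=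
    fun y => Literature.NumberTheory.Automorphic.Liu2021.LemD1IndexedNonVacuityInertCofinite.valued_toPlace_of_isUnramifiedIn E v hunr w y
  have hϖv : Valued.v (toPlace v w k₀) = WithZero.exp (-1 : ℤ) := by rw [hιv, hk₀]
  have hjv : ∀ y : w.1.adicCompletion E, Valued.v (toPlace w.1 w₁ y) = Valued.v y ^ 2 :=
    valued_toPlace_eq_sq_of_eisenstein v hunr w w₁ haF hk₀ hθ hθv
  -- `χ_g` rootless and `g₁₀ ≠ 0` from the Eisenstein data (★ (c5-i) `charpoly_ne_zero_of_eisensteinData`)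
  obtain ⟨-, -, hirr, h10⟩ := charpoly_ne_zero_of_eisensteinData hϖv hΘ hΘd hΘt
  have hK2 : Module.finrank (w.1.adicCompletion E) (w₁.1.adicCompletion M) = 2 := finrank_eq_two_of_root hirr hlam hcoordlam
  have hnormK : ∀ x z : w₁.1.adicCompletion M, z ≠ 0 → s' z = z → Valued.v (x * s' x) = Valued.v z → ∃ t : w₁.1.adicCompletion M, t * s' t = z :=
    fun x z hz0 hsz hx => exists_mul_map_eq_of_valuation_eq_inertPlace v w w₁ s' hs's' hnorm1 x z hz0 hsz hx
  -- ### ★ (c5-ii) FILE A: the integral Eisenstein frame at the place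
  obtain ⟨ιO, σO, jO, σKO, thetaO, aFO, k₀F, ξ, b₀, hϖF, hϖE, -, hσOc, hjOc, hσKOc, hθc, -, -, -, hσι, hfixO, hιinj, hιu, hb₀, hσ₁j, hσ₁θ, hθO, haFO,
    hk₀O, hcoordO, hnormE, hnorm₁, hnormEb, hιϖ, hk₁, hq, hξ, hσval, hs'val, hOK⟩ :=
    exists_integralEisensteinFrame_inertPlace c v hc hunr w hw w₁ haF hk₀ s' hθ hcoord hint hs'ι hs'θ hs'O hs'v hnorm1
  subst hθc
  -- ### ★ γ
  exact ncard_isSelfDualLattice_stable_eq_phiTHn_of_eisensteinData (galAdicCompletionMap (L := E) c hw) s' hσσ hs's' hσO hK2 J hJ hJh cfr φ hφ hstar hOK hs'ι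
    jO hjOc σO hσOc σKO hσKOc hσval hs'val ιO thetaO hσι hfixO hιinj hιu ⟨b₀, hb₀⟩ hσ₁j hσ₁θ hθO haFO hk₀O hcoordO hnormE hnorm₁ hϖF hϖE hιϖ hk₁ hq hξ hnormEb
    hσvV hjv hθv hϖv hcoord hnormK hL₀ htrans φb hφb hg hu h10 hirr hΘ hΘd hΘt hrel hn hb hlam hφx hK hall hcoordlam P hP hPx hgateV hI

include hc hunr haF hk₀ hθ hθv hcoord hint hs'ι hs'θ hs's' hs'O hs'v hnorm1 hJ hJh hL₀ htrans hφb hφ hstar hg hu hΘ hΘd hΘt hrel hn hb hlam hφx hK hall hcoordlam hP hPx hgateV in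
/-- **F5-(0), CLASS II: `#{Λ | IsSelfDualLattice σ_w (ι k₀) J Λ ∧ φ_b(g,u)·Λ ⊆ Λ} = Φ′(t″) = phiTHprimen q n N` AT THE INERT PLACE** — ★ γ
`ncard_isSelfDualLattice_stable_eq_phiTHprimen_of_eisensteinData` at the place, frame letters discharged as in the class-I head (class-II token at `x₀ = c·e₂`).
[cite: Rogawski1990, §4.9 Lemma 4.9.3 p. 56, Prop. 4.9.1 (b) p. 55] [cite: Kottwitz1986BaseChangeUnits, §1 pp. 240–241; §3] [cite: Flicker1998UnitaryFL, Props. 16–17 pp. 96–97; Theorem 18 p. 97] -/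
theorem ncard_isSelfDualLattice_stable_eq_phiTHprimen_inertPlace
    (hII : ∀ z : w.1.adicCompletion E, z ≠ 0 → valuation (w.1.adicCompletion E) (galAdicCompletionMap (L := E) c hw z * z *
      dotProduct (fun i => galAdicCompletionMap (L := E) c hw (((cfr : Matrix (Fin 3) (Fin 3) (w.1.adicCompletion E)) *ᵥ
        Pi.single (endoPerm (Sum.inr 0)) (1 : w.1.adicCompletion E)) i))
        ((J : Matrix (Fin 3) (Fin 3) (w.1.adicCompletion E)) *ᵥ ((cfr : Matrix (Fin 3) (Fin 3) (w.1.adicCompletion E)) *ᵥ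
          Pi.single (endoPerm (Sum.inr 0)) (1 : w.1.adicCompletion E)))) ≠ 1) :
    (({Λ : Submodule (Valued.integer (w.1.adicCompletion E)) (Fin 3 → w.1.adicCompletion E) |
        IsSelfDualLattice (galAdicCompletionMap (L := E) c hw) (toPlace v w k₀) (J : Matrix (Fin 3) (Fin 3) (w.1.adicCompletion E)) Λ ∧
        Λ.map ((Matrix.toLin' (φb (g, u))).restrictScalars (Valued.integer (w.1.adicCompletion E))) ≤ Λ}.ncard : ℕ) : ℚ) =
      phiTHprimen (Nat.card 𝓀[v.adicCompletion F]) n N := by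
  have hσσ : ∀ x, galAdicCompletionMap (L := E) c hw (galAdicCompletionMap (L := E) c hw x) = x :=
    galAdicCompletionMap_galAdicCompletionMap_of_smul_eq c w hc hw
  have hσO : ∀ x : 𝒪[w.1.adicCompletion E], galAdicCompletionMap (L := E) c hw x ∈ 𝒪[w.1.adicCompletion E] :=
    fun x => mem_integer_galAdicCompletionMap c v w hw x
  have hσvV : ∀ x : w.1.adicCompletion E, Valued.v (galAdicCompletionMap (L := E) c hw x) = Valued.v x :=
    fun x => valued_galAdicCompletionMap (L := E) c hw x
  have hιv : ∀ y : v.adicCompletion F, Valued.v (toPlace v w y) = Valued.v y :=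
    fun y => Literature.NumberTheory.Automorphic.Liu2021.LemD1IndexedNonVacuityInertCofinite.valued_toPlace_of_isUnramifiedIn E v hunr w y
  have hϖv : Valued.v (toPlace v w k₀) = WithZero.exp (-1 : ℤ) := by rw [hιv, hk₀]
  have hjv : ∀ y : w.1.adicCompletion E, Valued.v (toPlace w.1 w₁ y) = Valued.v y ^ 2 :=
    valued_toPlace_eq_sq_of_eisenstein v hunr w w₁ haF hk₀ hθ hθv
  -- `χ_g` rootless and `g₁₀ ≠ 0` from the Eisenstein data (★ (c5-i) `charpoly_ne_zero_of_eisensteinData`)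
  obtain ⟨-, -, hirr, h10⟩ := charpoly_ne_zero_of_eisensteinData hϖv hΘ hΘd hΘt
  have hK2 : Module.finrank (w.1.adicCompletion E) (w₁.1.adicCompletion M) = 2 := finrank_eq_two_of_root hirr hlam hcoordlam
  obtain ⟨ιO, σO, jO, σKO, thetaO, aFO, k₀F, ξ, b₀, hϖF, hϖE, -, hσOc, hjOc, hσKOc, hθc, -, -, -, hσι, hfixO, hιinj, hιu, hb₀, hσ₁j, hσ₁θ, hθO, haFO,
    hk₀O, hcoordO, hnormE, hnorm₁, hnormEb, hιϖ, hk₁, hq, hξ, hσval, hs'val, hOK⟩ :=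
    exists_integralEisensteinFrame_inertPlace c v hc hunr w hw w₁ haF hk₀ s' hθ hcoord hint hs'ι hs'θ hs'O hs'v hnorm1
  subst hθc
  exact ncard_isSelfDualLattice_stable_eq_phiTHprimen_of_eisensteinData (galAdicCompletionMap (L := E) c hw) s' hσσ hs's' hσO hK2 J hJ hJh cfr φ hφ hstar hOK hs'ι
    jO hjOc σO hσOc σKO hσKOc hσval hs'val ιO thetaO hσι hfixO hιinj hιu ⟨b₀, hb₀⟩ hσ₁j hσ₁θ hθO haFO hk₀O hcoordO hnormE hnorm₁ hϖF hϖE hιϖ hk₁ hq hξ hnormEb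
    hσvV hjv hϖv hcoord hL₀ htrans φb hφb hg hu h10 hirr hΘ hΘd hΘt hrel hn hb hlam hφx hK hall hcoordlam P hP hPx hgateV hII

end Literature.NumberTheory.Rogawski1990
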